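import Summits.BirchSwinnertonDyer.BirchSwinnertonDyer.Theorems.PrintCf2SplitBadTwoInertiaFixedTorsionLeFour
import Summits.BirchSwinnertonDyer.BirchSwinnertonDyer.Theorems.PrintCf2SplitBadTwoCMPrimaryModule
import HarnessLib

/-!
# Crux `PrintCf2.SplitBadTwoRankOneOfFacts` (stmt-BirchSwinnertonDyer-20368), road α v9.1 — S3c₂ piece (ii)-b (second half):
# `W*(K*_∞) = W*[2]` HAS EXACTLY TWO ELEMENTS, `Γ` acts trivially on it, and `v₂ #ker(control) ≤ 1` — on every S3c₂ frame over `K ∋ √−7`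

Cell `bsd-print-cf2`, LEAD seat `bsd-line-cf2-p1` g11 (prover-bsd-line-cf2-p1-g11-0); `--supports stmt-BirchSwinnertonDyer-20368` (helper,
Theses-free). HONEST FRAMING: nothing here closes the crux or a registered stub; BSD is not proved by any of this; no summit statement is
proved by this seat. No definition, no named fact, no `sorry`. The extra binder `θ² = −7` (`√−7 ∈ K`) is the one every SATISFIABLE S3c₂
frame has (a `K`-rational `π` with `π² = π − 2` forces it, Silverman *AT* II.2.2 — not used here; -w2 g7 and -w8 display the same binder).

WHAT. p654573 proved `W*(K*_∞) := W*^{ker κ'}` finite and p656082 `#W*(K*_∞) ≤ 4` (Greenberg's `c_v ≤ 4` at the additive place above `7`,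
global currency). With -w2 g7's structure theorem for the named summand (`CMPrimes.endEigenPrimaryTorsion_two_structure`, p646843 lineage:
`C ⊓ C' = ⊥`, `#C[2^k] = 2^k`, `Γ_K` acts on `C[2^k]` by integer scalars; needs `θ² = −7`) this file pins the VALUE:
* `smul_eq_self_of_two_nsmul_eq_zero` — `Γ_K` fixes `C[2]` and `C'[2]` pointwise (a scalar on a point of order `2` is `0` or the identity,
  and `σ` is injective);
* `natCard_fixedPoints_mul_two_le` — the injection `W*(K*_∞) × C'[2] ↪ E[2^∞]^{ker κ'}`, `(x, y) ↦ x + y` (`C ⊓ C' = ⊥`), so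
  `2 · #W*(K*_∞) ≤ #E[2^∞]^{ker κ'} ≤ 4`;
* **`natCard_fixedPoints_kerSubgroup_of_frame_eq_two`** — `#W*(K*_∞) = 2` (`≥ 2`: `C[2] ⊆ W*(K*_∞)`; `≤ 2`: the product bound);
* `smul_eq_self_of_mem_fixedPoints_of_frame` — EVERY `σ ∈ Γ_K` (in particular the generator `γ'`) acts trivially on `W*(K*_∞)`, so
  `(γ' − 1) W*(K*_∞) = 0` and `#(W*(K*_∞) ⧸ (γ' − 1)) = 2` (`natCard_fixedPoints_quotient_subOne_of_frame_eq_two`);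
* **`natCard_ker_control_of_frame_le_two`**, **`padicValNat_card_ker_control_of_frame_le_one`** — the KERNEL term of -w7's four-index
  identity (p652120) satisfies `#ker ≤ 2`, `v₂ #ker ≤ 1`, CLASS-UNIFORMLY (every member, every `π, r`, every line unramified outside `v̄`).
This is Agboola's Prop. 3.2 kernel bound made exact at the additive prime: `ker(H¹(K, W*) → H¹(K*_∞, W*)) = H¹(Γ, W*(K*_∞)) = Hom(Γ, ℤ/2)`
has order exactly `2`, and the control kernel is its intersection with `𝔖_{v̄}(K, W*)`.
presearch: Agboola 2007 Prop. 3.2; Greenberg LNM 1716 Lemma 3.1/3.3; Rubin LNM 1716 §2 — held; no fact filed.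

References: [Agboola2007] §3 Prop. 3.2; [GreenbergLNM1716] §3 Lemmas 3.1, 3.3; [Rubin1999] §2, Prop. 5.4; [SilvermanAEC2009] III.8.1.
-/

noncomputable section

open scoped Classical

set_option linter.dupNamespace false
set_option autoImplicit false

open NumberField IsDedekindDomain Field WeierstrassCurve
open Literature.NumberTheory.EllipticCurves Literature.NumberTheory.EllipticCurves.GreenbergSelmer
open Literature.NumberTheory.EllipticCurves.Agboola2007
open Literature.NumberTheory.EllipticCurves.IwasawaDual
open Literature.NumberTheory.EllipticCurves.ResKernel
open Literature.NumberTheory.GaloisRepresentations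

namespace Summit.BirchSwinnertonDyer.BirchSwinnertonDyer.Theorems.PrintCf2.RestrictedSelmerPair

section Sharp

open Summit.BirchSwinnertonDyer.BirchSwinnertonDyer.Theorems.PrintCf2.AdditiveAtSeven
open Summit.BirchSwinnertonDyer.BirchSwinnertonDyer.Theorems.PrintCf2.CMPrimes

variable {K : Type} [Field K] [NumberField K]

/-- **`Γ_K` fixes the `2`-torsion of the CM summand pointwise** (`√−7 ∈ K`): `σ` acts on `C[2]` as an integer scalar `N`
(`endEigenPrimaryTorsion_two_structure`), and on a point `x` with `2x = 0` this is `x` or `0`; `σ` being injective, `σ x = x`.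
[cite: Rubin1999, §2 and Prop. 5.4] -/
theorem smul_eq_self_of_two_nsmul_eq_zero (W : WeierstrassCurve ℚ) [W.IsElliptic] (hj : W.j = -3375) {θ : K} (hθ : θ ^ 2 = -7)
    (π : (W.baseChange K).endRing) (hrel : (π : AddMonoid.End (W.baseChange K).geomPoints) * π = π - 2)
    {r : ℤ_[2]} (hr : r * r = r - 2) (σ : absoluteGaloisGroup K)
    {x : (W.baseChange K).geomPrimaryTorsion 2} (hx : x ∈ (W.baseChange K).endEigenPrimaryTorsion 2 π r) (h2 : 2 • x = 0) :
    σ • x = x := by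
  obtain ⟨-, -, -, -, -, -, -, hscal⟩ := endEigenPrimaryTorsion_two_structure W hj K hθ π hrel hr
  obtain ⟨N, hN⟩ := hscal σ 1
  have hσx : σ • x = N • x := hN x hx (by simpa using h2)
  -- `N • x` is `x` or `0` according to the parity of `N`
  obtain ⟨m, hm | hm⟩ := Int.even_or_odd' N
  · -- `N` even: `σ • x = 0`, hence `x = 0`
    have h0 : σ • x = 0 := by
      rw [hσx, hm, mul_comm, mul_zsmul, two_zsmul, ← two_nsmul, h2, zsmul_zero]
    have hx0 : x = 0 := by
      have := congrArg (fun y ↦ σ⁻¹ • y) h0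
      simpa only [inv_smul_smul, smul_zero] using this
    rw [hx0, smul_zero]
  · rw [hσx, hm, add_zsmul, one_zsmul, mul_comm, mul_zsmul, two_zsmul, ← two_nsmul, h2, zsmul_zero, zero_add]

/-- **`C[2] ⊆ W*(K*_∞)`**: the `2`-torsion of the summand is fixed by all of `Γ_K`, a fortiori by `ker κ'`; hence `2 ≤ #W*(K*_∞)` whenever the
latter is finite. [cite: Rubin1999, §2 and Prop. 5.4] [cite: Agboola2007, §3 Prop. 3.2] -/
theorem two_le_natCard_fixedPoints_kerSubgroup (W : WeierstrassCurve ℚ) [W.IsElliptic] (hj : W.j = -3375) {θ : K} (hθ : θ ^ 2 = -7)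
    (π : (W.baseChange K).endRing) (hrel : (π : AddMonoid.End (W.baseChange K).geomPoints) * π = π - 2)
    {r : ℤ_[2]} (hr : r * r = r - 2) (κ' : ZpExtension K 2)
    [Finite (FixedPoints.addSubgroup κ'.kerSubgroup ↥((W.baseChange K).endEigenPrimaryTorsion 2 π r))] :
    2 ≤ Nat.card (FixedPoints.addSubgroup κ'.kerSubgroup ↥((W.baseChange K).endEigenPrimaryTorsion 2 π r)) := by
  obtain ⟨-, -, -, -, -, hcard, -, -⟩ := endEigenPrimaryTorsion_two_structure W hj K hθ π hrel hr
  have h1 := hcard 1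
  simp only [pow_one] at h1
  -- the injection `C ⊓ E[2^∞][2] ↪ W*(K*_∞)`
  let f : ↥((W.baseChange K).endEigenPrimaryTorsion 2 π r ⊓ AddSubgroup.torsionBy ((W.baseChange K).geomPrimaryTorsion 2) (2 : ℕ)) →
      FixedPoints.addSubgroup κ'.kerSubgroup ↥((W.baseChange K).endEigenPrimaryTorsion 2 π r) :=
    fun x ↦ ⟨⟨(x : (W.baseChange K).geomPrimaryTorsion 2), (AddSubgroup.mem_inf.mp x.2).1⟩, fun τ ↦ by
      apply Subtype.ext
      change (τ : absoluteGaloisGroup K) • (x : (W.baseChange K).geomPrimaryTorsion 2) = x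
      exact smul_eq_self_of_two_nsmul_eq_zero W hj hθ π hrel hr _ (AddSubgroup.mem_inf.mp x.2).1
        (AddSubgroup.torsionBy.nsmul_iff.mp (AddSubgroup.mem_inf.mp x.2).2)⟩
  have hf : Function.Injective f := fun a b hab ↦ by
    have h := congrArg (fun y : FixedPoints.addSubgroup κ'.kerSubgroup ↥((W.baseChange K).endEigenPrimaryTorsion 2 π r) ↦
      ((y : ↥((W.baseChange K).endEigenPrimaryTorsion 2 π r)) : (W.baseChange K).geomPrimaryTorsion 2)) hab
    exact Subtype.ext h
  have hle := Nat.card_le_card_of_injective f hf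
  rw [h1] at hle
  exact hle

/-- **The product bound `#W*(K*_∞) · 2 ≤ #E[2^∞]^{ker κ'}`**: `(x, y) ↦ x + y` injects `W*(K*_∞) × C'[2]` into `E[2^∞]^{ker κ'}` (`C'[2]` is
`Γ_K`-fixed, `C ⊓ C' = ⊥`, `#C'[2] = 2`). [cite: Rubin1999, §2 and Prop. 5.4] -/
theorem natCard_fixedPoints_mul_two_le (W : WeierstrassCurve ℚ) [W.IsElliptic] (hj : W.j = -3375) {θ : K} (hθ : θ ^ 2 = -7)
    (π : (W.baseChange K).endRing) (hrel : (π : AddMonoid.End (W.baseChange K).geomPoints) * π = π - 2)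
    {r : ℤ_[2]} (hr : r * r = r - 2) (κ' : ZpExtension K 2)
    [Finite (FixedPoints.addSubgroup κ'.kerSubgroup ((W.baseChange K).geomPrimaryTorsion 2))] :
    Nat.card (FixedPoints.addSubgroup κ'.kerSubgroup ↥((W.baseChange K).endEigenPrimaryTorsion 2 π r)) * 2 ≤
      Nat.card (FixedPoints.addSubgroup κ'.kerSubgroup ((W.baseChange K).geomPrimaryTorsion 2)) := by
  set C := (W.baseChange K).endEigenPrimaryTorsion 2 π r
  set C' := (W.baseChange K).endEigenPrimaryTorsion 2 π (1 - r)
  have hr' : (1 - r) * (1 - r) = (1 - r) - 2 := by linear_combination hr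
  obtain ⟨hinf, -, -, -, -, -, -, -⟩ := endEigenPrimaryTorsion_two_structure W hj K hθ π hrel hr
  obtain ⟨-, -, -, -, -, hcard', -, -⟩ := endEigenPrimaryTorsion_two_structure W hj K hθ π hrel hr'
  have h1 : Nat.card ↥(C' ⊓ AddSubgroup.torsionBy ((W.baseChange K).geomPrimaryTorsion 2) (2 : ℕ)) = 2 := by
    have := hcard' 1; simpa only [pow_one] using this
  let T := ↥(C' ⊓ AddSubgroup.torsionBy ((W.baseChange K).geomPrimaryTorsion 2) (2 : ℕ))
  let f : FixedPoints.addSubgroup κ'.kerSubgroup ↥C × T → FixedPoints.addSubgroup κ'.kerSubgroup ((W.baseChange K).geomPrimaryTorsion 2) :=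
    fun xy ↦ ⟨((xy.1 : ↥C) : (W.baseChange K).geomPrimaryTorsion 2) + (xy.2 : (W.baseChange K).geomPrimaryTorsion 2), fun τ ↦ by
      change (τ : absoluteGaloisGroup K) • (((xy.1 : ↥C) : (W.baseChange K).geomPrimaryTorsion 2) +
        (xy.2 : (W.baseChange K).geomPrimaryTorsion 2)) = _
      rw [smul_add]
      congr 1
      · exact congrArg Subtype.val (xy.1.2 τ)
      · exact smul_eq_self_of_two_nsmul_eq_zero W hj hθ π hrel hr' _ (AddSubgroup.mem_inf.mp xy.2.2).1
          (AddSubgroup.torsionBy.nsmul_iff.mp (AddSubgroup.mem_inf.mp xy.2.2).2)⟩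
  have hf : Function.Injective f := by
    rintro ⟨a, b⟩ ⟨a', b'⟩ hab
    have h := congrArg (fun y : FixedPoints.addSubgroup κ'.kerSubgroup ((W.baseChange K).geomPrimaryTorsion 2) ↦
      (y : (W.baseChange K).geomPrimaryTorsion 2)) hab
    have hsum : ((a : ↥C) : (W.baseChange K).geomPrimaryTorsion 2) + (b : (W.baseChange K).geomPrimaryTorsion 2) =
        ((a' : ↥C) : (W.baseChange K).geomPrimaryTorsion 2) + (b' : (W.baseChange K).geomPrimaryTorsion 2) := h
    -- `a - a' = b' - b ∈ C ⊓ C' = ⊥`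
    have hdiff : ((a : ↥C) : (W.baseChange K).geomPrimaryTorsion 2) - ((a' : ↥C) : (W.baseChange K).geomPrimaryTorsion 2) =
        (b' : (W.baseChange K).geomPrimaryTorsion 2) - (b : (W.baseChange K).geomPrimaryTorsion 2) :=
      sub_eq_sub_iff_add_eq_add.mpr (hsum.trans (add_comm _ _))
    have hmemC : ((a : ↥C) : (W.baseChange K).geomPrimaryTorsion 2) - ((a' : ↥C) : (W.baseChange K).geomPrimaryTorsion 2) ∈ C :=
      C.sub_mem (a : ↥C).2 (a' : ↥C).2
    have hmemC' : (b' : (W.baseChange K).geomPrimaryTorsion 2) - (b : (W.baseChange K).geomPrimaryTorsion 2) ∈ C' :=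
      C'.sub_mem (AddSubgroup.mem_inf.mp b'.2).1 (AddSubgroup.mem_inf.mp b.2).1
    have hbot : ((a : ↥C) : (W.baseChange K).geomPrimaryTorsion 2) - ((a' : ↥C) : (W.baseChange K).geomPrimaryTorsion 2) ∈
        C ⊓ C' := ⟨hmemC, hdiff ▸ hmemC'⟩
    rw [hinf, AddSubgroup.mem_bot] at hbot
    have ha : a = a' := Subtype.ext (Subtype.ext (sub_eq_zero.mp hbot))
    have hb : b = b' := by
      rw [hbot] at hdiff
      exact Subtype.ext (sub_eq_zero.mp hdiff.symm).symm
    rw [ha, hb]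
  have hT : Nat.card T = 2 := h1
  haveI : Finite T := Nat.finite_of_card_ne_zero (by rw [hT]; norm_num)
  haveI : Finite (FixedPoints.addSubgroup κ'.kerSubgroup ↥C) := by
    refine Finite.of_injective (fun x : FixedPoints.addSubgroup κ'.kerSubgroup ↥C ↦
      (⟨((x : ↥C) : (W.baseChange K).geomPrimaryTorsion 2), fun τ ↦ congrArg Subtype.val (x.2 τ)⟩ :
        FixedPoints.addSubgroup κ'.kerSubgroup ((W.baseChange K).geomPrimaryTorsion 2))) ?_
    intro a b hab
    have h1 := congrArg Subtype.val hab
    exact Subtype.ext (Subtype.ext h1)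
  have := Nat.card_le_card_of_injective f hf
  rwa [Nat.card_prod, hT] at this

/-- **`#W*(K*_∞) = 2` on every S3c₂ frame over `K ∋ √−7`** (member `C • W = cm7^{(d)}`, `K` imaginary quadratic with `θ² = −7`, `v̄ ∣ 2`,
`π² = π − 2`, `r² = r − 2`, `κ'` unramified outside `v̄`): `2 ≤ #` by `C[2] ⊆ W*(K*_∞)`, and `# · 2 ≤ #E[2^∞]^{ker κ'} ≤ 4` (p656082).
[cite: Agboola2007, §3 Prop. 3.2] [cite: GreenbergLNM1716, §3 Lemma 3.3 (p. 88)] [cite: Rubin1999, §2 and Prop. 5.4] -/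
theorem natCard_fixedPoints_kerSubgroup_of_frame_eq_two {d : ℤ} (hd0 : d ≠ 0) (W : WeierstrassCurve ℚ) [W.IsElliptic]
    (C : VariableChange ℚ) (hC : C • W = cm7.quadraticTwist (d : ℚ)) (hK : IsImaginaryQuadratic K) {θ : K} (hθ : θ ^ 2 = -7)
    (vbar : HeightOneSpectrum (𝓞 K)) (hvbar : ((2 : ℕ) : 𝓞 K) ∈ vbar.asIdeal)
    (π : (W.baseChange K).endRing) (hrel : (π : AddMonoid.End (W.baseChange K).geomPoints) * π = π - 2)
    {r : ℤ_[2]} (hr : r * r = r - 2) (κ' : ZpExtension K 2) (hκ' : κ'.IsUnramifiedOutside vbar) :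
    Nat.card (FixedPoints.addSubgroup κ'.kerSubgroup ↥((W.baseChange K).endEigenPrimaryTorsion 2 π r)) = 2 := by
  have hj : W.j = -3375 := j_eq_of_smul_eq_cm7Twist hd0 W C hC
  obtain ⟨w, h7⟩ := exists_heightOneSpectrum_natCast_mem (K := K) (q := 7) (by norm_num)
  have h2w : ((2 : ℕ) : 𝓞 K) ∉ w.asIdeal := natCast_two_notMem_of_seven_mem w h7
  have hw : w ≠ vbar := fun h ↦ h2w (h ▸ hvbar)
  haveI : (W.baseChange K).IsElliptic := by rw [baseChange]; infer_instance
  have hadd := hasAdditiveReductionAt_baseChange_of_j_eq_cm7_of_finrank_eq_two K w hK.1 W hj h7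
  haveI := finite_fixedPoints_kerSubgroup_geomPrimaryTorsion_of_hasAdditiveReductionAt (W.baseChange K) κ' hκ' hw h2w hadd
  haveI := finite_fixedPoints_kerSubgroup_of_frame hd0 W C hC hK vbar hvbar π r κ' hκ'
  have hle4 := natCard_fixedPoints_kerSubgroup_geomPrimaryTorsion_le_four (W.baseChange K) κ' hκ' hw h2w hadd
  have hmul := natCard_fixedPoints_mul_two_le W hj hθ π hrel hr κ'
  have hge := two_le_natCard_fixedPoints_kerSubgroup W hj hθ π hrel hr κ'
  omega

/-- **`Γ_K` acts TRIVIALLY on `W*(K*_∞)`** (it is `C[2]`, or directly: a subgroup of `C` of order `2` with `C[2]` pointwise fixed — every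
element of a group of order `2` is killed by `2`). [cite: Rubin1999, §2] [cite: Agboola2007, §3 Prop. 3.2] -/
theorem smul_eq_self_of_mem_fixedPoints_of_frame {d : ℤ} (hd0 : d ≠ 0) (W : WeierstrassCurve ℚ) [W.IsElliptic]
    (C : VariableChange ℚ) (hC : C • W = cm7.quadraticTwist (d : ℚ)) (hK : IsImaginaryQuadratic K) {θ : K} (hθ : θ ^ 2 = -7)
    (vbar : HeightOneSpectrum (𝓞 K)) (hvbar : ((2 : ℕ) : 𝓞 K) ∈ vbar.asIdeal)
    (π : (W.baseChange K).endRing) (hrel : (π : AddMonoid.End (W.baseChange K).geomPoints) * π = π - 2)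
    {r : ℤ_[2]} (hr : r * r = r - 2) (κ' : ZpExtension K 2) (hκ' : κ'.IsUnramifiedOutside vbar)
    (σ : absoluteGaloisGroup K) (x : FixedPoints.addSubgroup κ'.kerSubgroup ↥((W.baseChange K).endEigenPrimaryTorsion 2 π r)) :
    σ • (x : ↥((W.baseChange K).endEigenPrimaryTorsion 2 π r)) = x := by
  have hj : W.j = -3375 := j_eq_of_smul_eq_cm7Twist hd0 W C hC
  have h2 := natCard_fixedPoints_kerSubgroup_of_frame_eq_two hd0 W C hC hK hθ vbar hvbar π hrel hr κ' hκ'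
  haveI : Finite (FixedPoints.addSubgroup κ'.kerSubgroup ↥((W.baseChange K).endEigenPrimaryTorsion 2 π r)) :=
    Nat.finite_of_card_ne_zero (by rw [h2]; norm_num)
  -- `2 • x = 0` in the group of order `2`
  have h2x : 2 • x = 0 := by
    have h := addOrderOf_dvd_natCard x
    rw [h2] at h
    exact addOrderOf_dvd_iff_nsmul_eq_zero.mp h
  have h2x' : 2 • ((x : ↥((W.baseChange K).endEigenPrimaryTorsion 2 π r)) : (W.baseChange K).geomPrimaryTorsion 2) = 0 := by
    have := congrArg (fun y : FixedPoints.addSubgroup κ'.kerSubgroup ↥((W.baseChange K).endEigenPrimaryTorsion 2 π r) ↦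
      ((y : ↥((W.baseChange K).endEigenPrimaryTorsion 2 π r)) : (W.baseChange K).geomPrimaryTorsion 2)) h2x
    simpa only [AddSubmonoidClass.coe_nsmul, ZeroMemClass.coe_zero] using this
  apply Subtype.ext
  rw [WeierstrassCurve.endEigenPrimaryTorsion.coe_smul]
  exact smul_eq_self_of_two_nsmul_eq_zero W hj hθ π hrel hr σ (x : ↥((W.baseChange K).endEigenPrimaryTorsion 2 π r)).2 h2x'

/-- **`#(W*(K*_∞) ⧸ (γ' − 1)) = 2`**: `γ' − 1 = 0` on `W*(K*_∞)`. [cite: GreenbergLNM1716, §3 Lemma 3.1] [cite: Agboola2007, §3 Prop. 3.2] -/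
theorem natCard_fixedPoints_quotient_subOne_of_frame_eq_two {d : ℤ} (hd0 : d ≠ 0) (W : WeierstrassCurve ℚ) [W.IsElliptic]
    (C : VariableChange ℚ) (hC : C • W = cm7.quadraticTwist (d : ℚ)) (hK : IsImaginaryQuadratic K) {θ : K} (hθ : θ ^ 2 = -7)
    (vbar : HeightOneSpectrum (𝓞 K)) (hvbar : ((2 : ℕ) : 𝓞 K) ∈ vbar.asIdeal)
    (π : (W.baseChange K).endRing) (hrel : (π : AddMonoid.End (W.baseChange K).geomPoints) * π = π - 2)
    {r : ℤ_[2]} (hr : r * r = r - 2) (κ' : ZpExtension K 2) (hκ' : κ'.IsUnramifiedOutside vbar) (γ' : absoluteGaloisGroup K) :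
    Nat.card (FixedPoints.addSubgroup κ'.kerSubgroup ↥((W.baseChange K).endEigenPrimaryTorsion 2 π r) ⧸
      (subOne κ'.kerSubgroup ↥((W.baseChange K).endEigenPrimaryTorsion 2 π r) γ').range) = 2 := by
  have hrange : (subOne κ'.kerSubgroup ↥((W.baseChange K).endEigenPrimaryTorsion 2 π r) γ').range = ⊥ := by
    rw [AddMonoidHom.range_eq_bot_iff]
    ext x
    rw [AddMonoidHom.zero_apply, ZeroMemClass.coe_zero, coe_subOne_apply,
      smul_eq_self_of_mem_fixedPoints_of_frame hd0 W C hC hK hθ vbar hvbar π hrel hr κ' hκ' γ' x, sub_self]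
  rw [hrange, Nat.card_congr (QuotientAddGroup.quotientBot).toEquiv]
  exact natCard_fixedPoints_kerSubgroup_of_frame_eq_two hd0 W C hC hK hθ vbar hvbar π hrel hr κ' hκ'

/-- **THE CONTROL KERNEL HAS AT MOST TWO ELEMENTS, `v₂ #ker ≤ 1`, on every S3c₂ frame over `K ∋ √−7`** — the kernel term of the
four-index identity (p652120) is bounded by ONE factor of `2`, class-uniformly: `#ker ≤ #(W*(K*_∞)/(γ'−1)) = 2` (p654573
`natCard_ker_resOfLe_le_top_le`). [cite: Agboola2007, §3 Prop. 3.2] [cite: GreenbergLNM1716, §3 Lemmas 3.1 and 3.3] -/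
theorem natCard_ker_control_of_frame_le_two {d : ℤ} (hd0 : d ≠ 0) (W : WeierstrassCurve ℚ) [W.IsElliptic]
    (C : VariableChange ℚ) (hC : C • W = cm7.quadraticTwist (d : ℚ)) (hK : IsImaginaryQuadratic K) {θ : K} (hθ : θ ^ 2 = -7)
    (vbar : HeightOneSpectrum (𝓞 K)) (hvbar : ((2 : ℕ) : 𝓞 K) ∈ vbar.asIdeal)
    (π : (W.baseChange K).endRing) (hrel : (π : AddMonoid.End (W.baseChange K).geomPoints) * π = π - 2)
    {r : ℤ_[2]} (hr : r * r = r - 2) (κ' : ZpExtension K 2) (hκ' : κ'.IsUnramifiedOutside vbar)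
    {γ' : absoluteGaloisGroup K} (hγ' : κ'.IsTopGenerator γ') :
    Nat.card ↥(restrictedSelmerBase ↥((W.baseChange K).endEigenPrimaryTorsion 2 π r) 2 vbar ⊓
        (resOfLe ↥((W.baseChange K).endEigenPrimaryTorsion 2 π r) (le_top : κ'.kerSubgroup ≤ ⊤)).ker) ≤ 2 ∧
      padicValNat 2 (Nat.card ↥(restrictedSelmerBase ↥((W.baseChange K).endEigenPrimaryTorsion 2 π r) 2 vbar ⊓
        (resOfLe ↥((W.baseChange K).endEigenPrimaryTorsion 2 π r) (le_top : κ'.kerSubgroup ≤ ⊤)).ker)) ≤ 1 := by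
  set M := ↥((W.baseChange K).endEigenPrimaryTorsion 2 π r)
  haveI hF := finite_fixedPoints_kerSubgroup_of_frame hd0 W C hC hK vbar hvbar π r κ' hκ'
  haveI : Finite (FixedPoints.addSubgroup κ'.kerSubgroup M ⧸ (subOne κ'.kerSubgroup M γ').range) := inferInstance
  haveI : (W.baseChange K).IsElliptic := by rw [baseChange]; infer_instance
  obtain ⟨hfin, hle⟩ := natCard_ker_resOfLe_le_top_le κ' M hγ'
    (continuous_smul_endEigenPrimaryTorsion (W.baseChange K) 2 π r)
  haveI := hfin
  have hinj := AddSubgroup.inclusion_injective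
    (inf_le_right : restrictedSelmerBase M 2 vbar ⊓ (resOfLe M (le_top : κ'.kerSubgroup ≤ ⊤)).ker ≤ _)
  have h2 : Nat.card ↥(restrictedSelmerBase M 2 vbar ⊓ (resOfLe M (le_top : κ'.kerSubgroup ≤ ⊤)).ker) ≤ 2 := by
    have h := ((Nat.card_le_card_of_injective _ hinj).trans hle)
    rwa [natCard_fixedPoints_quotient_subOne_of_frame_eq_two hd0 W C hC hK hθ vbar hvbar π hrel hr κ' hκ' γ'] at h
  refine ⟨h2, ?_⟩
  have : ∀ n : ℕ, n ≤ 2 → padicValNat 2 n ≤ 1 := by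
    intro n hn
    interval_cases n
    · simp
    · simp
    · simp
  exact this _ h2

end Sharp

end Summit.BirchSwinnertonDyer.BirchSwinnertonDyer.Theorems.PrintCf2.RestrictedSelmerPair

end
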